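import Summits.QuantumFields.BalabanUV.T4Continuum.Support.NE7SliceSupFlat
import Summits.QuantumFields.BalabanUV.T4Continuum.Support.NE3FrameFreeDecomposition
import Summits.QuantumFields.BalabanUV.T4Continuum.Support.NE3EnergyRateWSupRoutePiRInv
import HarnessLib

/-!
# NE7SliceStepLinear — THE LINEAR STEP OF THE REP♭ SUP INDUCTION ON THE T4 CARRIERS, EVERY LEVEL: an ARBITRARY periodic direction `A` (not tangent) with
# link bound `a`, flat-curl bound `ε′` and DATUM bound `β ≥ ‖dirIter L (k+1) 1 A‖` is, up to a lattice gradient `dσ`, of size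
# `K₁·L^{k+1}·ε′ + K₂·β∕L^{k+1}`; the gauge function is periodic with `‖σ‖ ≤ K₃·(L^{k+1}·a + β + L^{2(k+1)}·ε′)` — constants depending on `d`, `card n` only

Cell `pub-balaban`, sub-cell t4, lineage `b2b-balaban-t4-ne7-p1`, gen 73 (CRUX PROVER NE7 #1).  Memo `t4/b2b-balaban-t4-ne7-p1-g73/REP-FLAT-ROAD-v2.md` §2 (s3)–(s5),
with row NE3's SMOOTH RIGHT INVERSE in place of the `H_k`-lift: `x := A − R(φ)`, `φ := dirIter L (k+1) 1 A` (the level datum), `R = NE3SmoothRightInverseFlat.smoothRightInverse L k`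
(`cpushIter L k 1 (Rφ) = φ` — `cpushIter_flat_smoothRightInverse`; sup `‖Rφ‖ ≤ (2(d+1)+1)·24·8^d·β∕L^{k+1}` — `NE3SmoothRightInverseBounds.norm_smoothRightInverse_le`; flat curl
`≤ 48·8^d·β∕L^{2(k+1)}` per plaquette — `NE3SmoothRightInverseCurl.curlAt_flat_smoothRightInverse` + `NE3SmoothLiftCurl.norm_curlAt_flat_smoothLift_le`; periodic —
`smoothRightInverse_add_period`).  Then `x` is T4-TANGENT (`iterate_Tcoarse_sub`, `cpushIter_flat`), this gen's D `NE7SliceSupFlat.sliceSup_flat` gauges it: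
`‖x − dσ‖ ≤ K·L^{k+1}·(ε′ + 48·8^d·β∕L^{2(k+1)})`, and `A − dσ = (x − dσ) + Rφ`.
WHAT ([folklore]; 0 def, 0 sorry; dimension `d + 1`, `L ≥ 2`, every `k`, every `N ≥ 1`).  §1 `curlAt_flat_sub` (the flat curl is additive), `dirIter_flat_sub_smoothRightInverse`
(`x` is tangent); §2 **`sliceStep_linear`**: `∃ K₁ K₂ K₃ > 0` (functions of `d`, `card n`) such that for all `L ≥ 2`, `k`, `N ≥ 1`, every `(L^{k+1}N)`-periodic `A` and all
`a ≥ ‖A‖`, `ε′ ≥ ‖curlAt 1 A‖`, `β ≥ ‖dirIter L (k+1) 1 A‖`: there is an `(L^{k+1}N)`-periodic `σ` with `‖A(y,κ) − (σ(y+e_κ) − σ(y))‖ ≤ K₁·L^{k+1}·ε′ + K₂·β∕L^{k+1}` and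
`‖σ(y)‖ ≤ K₃·(L^{k+1}·a + β + L^{2(k+1)}·ε′)`.  In the induction (memo (s6)): `a = C′δ∕L^k`, `ε′ = O(δ∕M²)`, `β = β₀ = O(δ)` ⟹ new field `O(δ·L^{k+1}∕M² + δ∕L^{k+1})`,
`‖σ‖ = O(L·C′δ)` ABSOLUTELY.
HONEST FRAMING (page 1): LINEAR bookkeeping over D and row NE3's right inverse BY NAME; [B8] (1.36) is a TEXT LOCATION; the NONLINEAR step (BCH junk, pinning, the datum
letter) and REP♭ are NOT proved; (APE) at the trivial flat datum conditional on REP♭; NOT NE7; spine 0∕9; finite T⁴ rung (B)+1 — NOT infinite volume, NOT mass gap, NOT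
BetaPertH, NOT Clay.  Continuum YM on T⁴ ⇐ BetaPertH ∧ nine spine estimates (0/9 proved); BetaPertH ⇐ (D1) ∧ (D4) ∧ CAP+tail; G-an2-4 gates asym, D1 and NE2/3/4.
-/

set_option autoImplicit false

open scoped BigOperators Matrix Matrix.Norms.L2Operator
open Finset

namespace Summit.QuantumFields.BalabanUV.T4Continuum.NE7SliceStepLinear

open Literature.MathematicalPhysics.QuantumFieldTheory.Balaban1983to89
open B7Prop1Explicit (Site e e_apply)
open T4AveragingDeficitWall (curlAt)
open T4AveragingDeficitWallBoundary (IsPeriodicCfg)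
open AveragingDeficitPeriodicCounting (IsPeriodicDir)
open AveragingDeficitMultiLevelPrep (tower)
open BlockAveragePushDirSplit (flat)
open SmoothRefineNeutral (Tcoarse)
open NE3TangentCovariantTower (dirIter)
open NE3CpushGaugeCovariance (dirIter_succ_eq_cpushIter)
open NE3SmoothLiftCurl (curlAt_flat_eq norm_curlAt_flat_smoothLift_le)
open NE3SmoothRightInverseFlat (smoothRightInverse cpushIter_flat cpushIter_flat_smoothRightInverse)
open NE3SmoothRightInverseCurl (curlAt_flat_smoothRightInverse)
open NE3SmoothRightInverseBounds (norm_smoothRightInverse_le smoothRightInverse_add_period)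
open NE3FrameFreeDecomposition (iterate_Tcoarse_sub)
open NE3FramePotBoundW (tower_eq_pow_mul)
open NE3EnergyRateWSupRoutePiRInv (isPeriodicDir_dirIter)
open NE7SliceSupFlat (sliceSup_flat)

noncomputable section

variable {d : ℕ} {n : Type*} [Fintype n] [DecidableEq n]

/-! ## §1 The tangent part of a direction -/

/-- the flat curl of a difference. [folklore] -/
theorem curlAt_flat_sub (A B : Site (d + 1) → Fin (d + 1) → Matrix n n ℂ) (x : Site (d + 1)) (μ ν : Fin (d + 1)) :
    curlAt (flat (d := d + 1) (n := n)) (fun y κ => A y κ - B y κ) x μ ν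
      = curlAt (flat (d := d + 1) (n := n)) A x μ ν - curlAt (flat (d := d + 1) (n := n)) B x μ ν := by
  rw [curlAt_flat_eq, curlAt_flat_eq, curlAt_flat_eq]
  abel

/-- **SUBTRACTING THE SMOOTH RIGHT INVERSE OF ITS DATUM MAKES A DIRECTION TANGENT**: `dirIter L (k+1) 1 (A − R(dirIter L (k+1) 1 A)) = 0` (`L ≥ 2`). [folklore] -/
theorem dirIter_flat_sub_smoothRightInverse {L : ℕ} (hL : 2 ≤ L) (k : ℕ) (A : Site (d + 1) → Fin (d + 1) → Matrix n n ℂ) :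
    dirIter L (k + 1) (flat (d := d + 1) (n := n))
        (fun y κ => A y κ - smoothRightInverse L k (dirIter L (k + 1) (flat (d := d + 1) (n := n)) A) y κ) = 0 := by
  have hL1 : 1 ≤ L := by omega
  funext z κ
  rw [dirIter_succ_eq_cpushIter, cpushIter_flat hL1, iterate_Tcoarse_sub, ← cpushIter_flat hL1, ← cpushIter_flat hL1,
    cpushIter_flat_smoothRightInverse hL, ← dirIter_succ_eq_cpushIter]
  simp only [sub_self, Pi.zero_apply]

/-! ## §2 THE LINEAR STEP -/

/-- **THE LINEAR STEP OF THE SUP INDUCTION, EVERY LEVEL** (dimension `d + 1`): there are `K₁, K₂, K₃ > 0` depending on `d`, `card n` only such that for all `L ≥ 2`,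
`k`, `N ≥ 1`, every `(L^{k+1}N)`-periodic direction `A` and all bounds `a ≥ ‖A(y,κ)‖`, `ε′ ≥ ‖curlAt 1 A z μ ν‖`, `β ≥ ‖dirIter L (k+1) 1 A z κ‖` there is an
`(L^{k+1}N)`-periodic `σ : Site → Matrix n n ℂ` with **`‖A(y,κ) − (σ(y + e_κ) − σ(y))‖ ≤ K₁·L^{k+1}·ε′ + K₂·β∕L^{k+1}`** and
**`‖σ(y)‖ ≤ K₃·(L^{k+1}·a + β + L^{2(k+1)}·ε′)`**. [folklore] -/
theorem sliceStep_linear [Nonempty n] :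
    ∃ K₁ K₂ K₃ : ℝ, 0 < K₁ ∧ 0 < K₂ ∧ 0 < K₃ ∧ ∀ (L : ℕ), 2 ≤ L → ∀ (k N : ℕ) [NeZero N]
      (A : Site (d + 1) → Fin (d + 1) → Matrix n n ℂ), IsPeriodicDir A ((L ^ (k + 1) * N : ℕ) : ℤ) →
      ∀ (a : ℝ), (∀ (y : Site (d + 1)) (κ : Fin (d + 1)), ‖A y κ‖ ≤ a) →
      ∀ (ε' : ℝ), (∀ (z : Site (d + 1)) (μ ν : Fin (d + 1)), ‖curlAt (flat (d := d + 1) (n := n)) A z μ ν‖ ≤ ε') →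
      ∀ (β : ℝ), (∀ (z : Site (d + 1)) (κ : Fin (d + 1)), ‖dirIter L (k + 1) (flat (d := d + 1) (n := n)) A z κ‖ ≤ β) →
      ∃ σ : Site (d + 1) → Matrix n n ℂ,
        (∀ (y : Site (d + 1)) (ι : Fin (d + 1)), σ (y + ((L ^ (k + 1) * N : ℕ) : ℤ) • e ι) = σ y) ∧
        (∀ (y : Site (d + 1)) (κ : Fin (d + 1)), ‖A y κ - (σ (y + e κ) - σ y)‖ ≤ K₁ * (L : ℝ) ^ (k + 1) * ε' + K₂ * β / (L : ℝ) ^ (k + 1)) ∧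
        (∀ y : Site (d + 1), ‖σ y‖ ≤ K₃ * ((L : ℝ) ^ (k + 1) * a + β + ((L : ℝ) ^ (k + 1)) ^ 2 * ε')) := by
  obtain ⟨K, hK, hD⟩ := sliceSup_flat (d := d) (n := n)
  -- the right-inverse constants (dimension `d + 1`)
  set CR : ℝ := (2 * ((d + 1 : ℕ) : ℝ) + 1) * (24 * (8 : ℝ) ^ d) with hCR
  set CC : ℝ := 48 * (8 : ℝ) ^ d with hCC
  have hCR0 : 0 < CR := by positivity
  have hCC0 : 0 < CC := by positivity
  refine ⟨K, K * CC + CR, Fintype.card n * ((d + 1 : ℕ) : ℝ) * (2 + 2 * CR + K + K * CC) + 1, hK, by positivity, by positivity,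
    fun L hL k N _ A hAP a ha ε' hε' β hβ => ?_⟩
  have hL1 : 1 ≤ L := by omega
  have hd1 : 1 ≤ d + 1 := by omega
  have hM2 : 2 ≤ L ^ (k + 1) := NE3SmoothRightInverseBounds.two_le_pow_succ hL k
  have hLpos : (0 : ℝ) < (L : ℝ) ^ (k + 1) := by positivity
  have hL1r : (1 : ℝ) ≤ (L : ℝ) ^ (k + 1) := one_le_pow₀ (by exact_mod_cast hL1)
  have ha0 : 0 ≤ a := (norm_nonneg _).trans (ha 0 0)
  have hε0 : 0 ≤ ε' := (norm_nonneg _).trans (hε' 0 0 0)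
  have hβ0 : 0 ≤ β := (norm_nonneg _).trans (hβ 0 0)
  -- the datum and its lift
  set φ := dirIter L (k + 1) (flat (d := d + 1) (n := n)) A with hφ
  have hφP : IsPeriodicDir φ (N : ℤ) := by
    have hT : ((tower L N (k + 1) : ℕ) : ℤ) = ((L ^ (k + 1) * N : ℕ) : ℤ) := by rw [tower_eq_pow_mul]
    refine isPeriodicDir_dirIter L N (k + 1) (W := flat) (fun _ _ _ => rfl) ?_
    rw [hT]; exact hAP
  set R := smoothRightInverse L k φ with hR
  have hRsup : ∀ (y : Site (d + 1)) (α : Fin (d + 1)), ‖R y α‖ ≤ CR / (L : ℝ) ^ (k + 1) * β := by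
    intro y α
    have h := norm_smoothRightInverse_le (n := n) hL hd1 k φ hβ y α
    rw [hCR]
    simpa [Nat.add_sub_cancel] using h
  have hRcurl : ∀ (z : Site (d + 1)) (μ ν : Fin (d + 1)), ‖curlAt (flat (d := d + 1) (n := n)) R z μ ν‖ ≤ CC * β / ((L : ℝ) ^ (k + 1)) ^ 2 := by
    intro z μ ν
    by_cases hμν : μ = ν
    · subst hμν
      rw [curlAt_flat_eq, sub_self, norm_zero]; positivity
    rw [hR, curlAt_flat_smoothRightInverse]
    refine (norm_curlAt_flat_smoothLift_le hM2 hd1 φ z hμν).trans ?_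
    rw [hCC, Nat.add_sub_cancel]
    push_cast
    have h2 : ‖φ (SmoothRefineBlocks.blk (L ^ (k + 1)) z) ν‖ + ‖φ (SmoothRefineBlocks.blk (L ^ (k + 1)) z) μ‖ ≤ 2 * β := by linarith [hβ (SmoothRefineBlocks.blk (L ^ (k + 1)) z) ν, hβ (SmoothRefineBlocks.blk (L ^ (k + 1)) z) μ]
    calc 24 * (8 : ℝ) ^ d / ((L : ℝ) ^ (k + 1)) ^ 2 * (‖φ (SmoothRefineBlocks.blk (L ^ (k + 1)) z) ν‖ + ‖φ (SmoothRefineBlocks.blk (L ^ (k + 1)) z) μ‖)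
        ≤ 24 * (8 : ℝ) ^ d / ((L : ℝ) ^ (k + 1)) ^ 2 * (2 * β) := mul_le_mul_of_nonneg_left h2 (by positivity)
      _ = 48 * (8 : ℝ) ^ d * β / ((L : ℝ) ^ (k + 1)) ^ 2 := by ring
  -- the tangent part
  set x : Site (d + 1) → Fin (d + 1) → Matrix n n ℂ := fun y κ => A y κ - R y κ with hx
  have hxT : dirIter L (k + 1) (flat (d := d + 1) (n := n)) x = 0 := dirIter_flat_sub_smoothRightInverse hL k A
  have hxP : IsPeriodicDir x ((L ^ (k + 1) * N : ℕ) : ℤ) := by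
    intro y κ ι
    simp only [hx]
    rw [hAP y κ ι, hR, smoothRightInverse_add_period hL1 k (fun z τ κ' => hφP z τ κ')]
  have hxsup : ∀ (y : Site (d + 1)) (κ : Fin (d + 1)), ‖x y κ‖ ≤ a + CR / (L : ℝ) ^ (k + 1) * β := fun y κ =>
    (norm_sub_le _ _).trans (add_le_add (ha y κ) (hRsup y κ))
  have hxcurl : ∀ (z : Site (d + 1)) (μ ν : Fin (d + 1)), ‖curlAt (flat (d := d + 1) (n := n)) x z μ ν‖ ≤ ε' + CC * β / ((L : ℝ) ^ (k + 1)) ^ 2 := by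
    intro z μ ν
    rw [hx, curlAt_flat_sub]
    exact (norm_sub_le _ _).trans (add_le_add (hε' z μ ν) (hRcurl z μ ν))
  -- D on the tangent part
  obtain ⟨σ, hσP, hσ1, hσ2⟩ := hD L hL1 k N x hxP hxT _ hxcurl _ hxsup
  refine ⟨σ, hσP, fun y κ => ?_, fun y => ?_⟩
  · -- `A − dσ = (x − dσ) + R`
    have hsplit : A y κ - (σ (y + e κ) - σ y) = (x y κ - (σ (y + e κ) - σ y)) + R y κ := by simp only [hx]; abel
    rw [hsplit]
    calc _ ≤ ‖x y κ - (σ (y + e κ) - σ y)‖ + ‖R y κ‖ := norm_add_le _ _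
      _ ≤ K * (L : ℝ) ^ (k + 1) * (ε' + CC * β / ((L : ℝ) ^ (k + 1)) ^ 2) + CR / (L : ℝ) ^ (k + 1) * β := add_le_add (hσ1 y κ) (hRsup y κ)
      _ = K * (L : ℝ) ^ (k + 1) * ε' + (K * CC + CR) * β / (L : ℝ) ^ (k + 1) := by field_simp; ring
  · refine (hσ2 y).trans ?_
    -- bookkeeping of the sup of the gauge function
    have hcard1 : (1 : ℝ) ≤ Fintype.card n := by exact_mod_cast Fintype.card_pos
    have e1 : CR / (L : ℝ) ^ (k + 1) * β ≤ CR * β := by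
      rw [div_mul_eq_mul_div]; exact div_le_self (by positivity) hL1r
    have e2 : CC * β / ((L : ℝ) ^ (k + 1)) ^ 2 ≤ CC * β := div_le_self (by positivity) (one_le_pow₀ hL1r)
    have h1 : ((L : ℝ) ^ (k + 1) - 1) * (2 * (a + CR / (L : ℝ) ^ (k + 1) * β) + K * (L : ℝ) ^ (k + 1) * (ε' + CC * β / ((L : ℝ) ^ (k + 1)) ^ 2))
        ≤ (2 + 2 * CR + K + K * CC) * ((L : ℝ) ^ (k + 1) * a + β + ((L : ℝ) ^ (k + 1)) ^ 2 * ε') := by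
      have hM : (L : ℝ) ^ (k + 1) - 1 ≤ (L : ℝ) ^ (k + 1) := by linarith
      have hpos : 0 ≤ 2 * (a + CR / (L : ℝ) ^ (k + 1) * β) + K * (L : ℝ) ^ (k + 1) * (ε' + CC * β / ((L : ℝ) ^ (k + 1)) ^ 2) := by positivity
      calc _ ≤ (L : ℝ) ^ (k + 1) * (2 * (a + CR / (L : ℝ) ^ (k + 1) * β) + K * (L : ℝ) ^ (k + 1) * (ε' + CC * β / ((L : ℝ) ^ (k + 1)) ^ 2)) :=
            mul_le_mul_of_nonneg_right hM hpos
        _ = 2 * ((L : ℝ) ^ (k + 1) * a) + 2 * CR * β + K * (((L : ℝ) ^ (k + 1)) ^ 2 * ε') + K * CC * β := by field_simp; ring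
        _ ≤ _ := by nlinarith [mul_nonneg hK.le hβ0, mul_nonneg hCR0.le hβ0, mul_nonneg hK.le (mul_nonneg hCC0.le hβ0),
              mul_nonneg (mul_nonneg hK.le hCC0.le) (mul_nonneg hLpos.le ha0), mul_nonneg hCR0.le (mul_nonneg hLpos.le ha0),
              mul_nonneg hK.le (mul_nonneg hLpos.le ha0), mul_nonneg (pow_nonneg hLpos.le 2) hε0, mul_nonneg hCC0.le (mul_nonneg (pow_nonneg hLpos.le 2) hε0),
              mul_nonneg hCR0.le (mul_nonneg (pow_nonneg hLpos.le 2) hε0), mul_nonneg hLpos.le ha0]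
    have h0 : 0 ≤ (L : ℝ) ^ (k + 1) * a + β + ((L : ℝ) ^ (k + 1)) ^ 2 * ε' := by positivity
    calc (Fintype.card n : ℝ) * (((d + 1 : ℕ) : ℝ) * ((L : ℝ) ^ (k + 1) - 1) * (2 * (a + CR / (L : ℝ) ^ (k + 1) * β) + K * (L : ℝ) ^ (k + 1) * (ε' + CC * β / ((L : ℝ) ^ (k + 1)) ^ 2)))
        = (Fintype.card n : ℝ) * ((d + 1 : ℕ) : ℝ) * (((L : ℝ) ^ (k + 1) - 1) * (2 * (a + CR / (L : ℝ) ^ (k + 1) * β) + K * (L : ℝ) ^ (k + 1) * (ε' + CC * β / ((L : ℝ) ^ (k + 1)) ^ 2))) := by ring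
      _ ≤ (Fintype.card n : ℝ) * ((d + 1 : ℕ) : ℝ) * ((2 + 2 * CR + K + K * CC) * ((L : ℝ) ^ (k + 1) * a + β + ((L : ℝ) ^ (k + 1)) ^ 2 * ε')) :=
          mul_le_mul_of_nonneg_left h1 (by positivity)
      _ ≤ (Fintype.card n * ((d + 1 : ℕ) : ℝ) * (2 + 2 * CR + K + K * CC) + 1) * ((L : ℝ) ^ (k + 1) * a + β + ((L : ℝ) ^ (k + 1)) ^ 2 * ε') := by nlinarith

end

end Summit.QuantumFields.BalabanUV.T4Continuum.NE7SliceStepLinear
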